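import Mathlib
import Literature.Geometry.DiscreteGeometry.MultiregularPointSystems
import Summits.AtomisticToContinuum.Crystallization.Theorems.IsometryAtomsAtomicLawChargesCrystalFinitePointGroupA
import Summits.AtomisticToContinuum.Crystallization.Theorems.IsometryAtomsAtomicLawChargesCrystalFinitePointGroupB

/-!
# Coaxial collapse: finitely many symmetry orbits ⇒ finite point group (stub `stub_finitePointGroup`)

Stub FPG of the line `Sketch` of the crux `IsometryAtoms.AtomicLawChargesCrystal`
(stmt-AtomisticToContinuum-15778): Bieberbach's first theorem for the case at hand.  For a Delone set
`D ⊆ ℝ³` with finitely many `Sym(D)`-orbits the point group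
`Π = {g.linearIsometryEquiv | g '' D = D}` is finite.  The SO(3) facts (T0 accumulation, T1 fixed unit
vector, T2 fixed space is the axis, T7 `A - 1` is onto `u^⊥`) and Bieberbach's lemma G1a (small linear parts
of symmetries commute) are hypotheses of the registered statement.

Proof (helper files `…FinitePointGroupA/B`):  if `Π` is infinite, T0 gives a symmetry `g₀` with nontrivial
`1/20`-small linear part `B₀`, with axis `u` (T1).  By part B, `g₀` commutes with all its conjugates and the
linear part of every conjugate fixes `u`; here we show that the axis set `ℓ₀ = {x | g₀ x - x ∈ ℝ u}` is the
line `c₀ + ℝ u` (`fpg_axis_point` via T7, `fpg_axis_structure` via T2) and that `g c₀ ∈ ℓ₀` for every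
symmetry `g` (`fpg_axis_invariant`).  Hence the orbit `Sym(D) · 0` stays at distance `dist 0 c₀` from the
line `ℓ₀`, contradicting the cocompactness of the orbit (part A, from finitely many orbits) at the point
`c₀ + (dist 0 c₀ + R₁ + 1) w`, `w ⊥ u` a unit vector.
-/

namespace Summit.AtomisticToContinuum.Crystallization.Theorems.IsometryAtomsAtomicLawChargesCrystal

open Metric

section AxisLine

variable
  (hT2 : ∀ A : EuclideanSpace ℝ (Fin 3) ≃ₗᵢ[ℝ] EuclideanSpace ℝ (Fin 3),
    (∀ x : EuclideanSpace ℝ (Fin 3), ‖A x - x‖ ≤ ‖x‖ / 2) → ∀ u : EuclideanSpace ℝ (Fin 3), ‖u‖ = 1 →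
      A u = u → (∃ x : EuclideanSpace ℝ (Fin 3), A x ≠ x) → ∀ v : EuclideanSpace ℝ (Fin 3), A v = v →
        ∃ c : ℝ, v = c • u)
  {g₀ : EuclideanSpace ℝ (Fin 3) ≃ᵃⁱ[ℝ] EuclideanSpace ℝ (Fin 3)}
  (hsm₀ : ∀ x : EuclideanSpace ℝ (Fin 3), ‖g₀.linearIsometryEquiv x - x‖ ≤ 1 / 20 * ‖x‖)
  (hne₀ : ∃ x : EuclideanSpace ℝ (Fin 3), g₀.linearIsometryEquiv x ≠ x)
  {u : EuclideanSpace ℝ (Fin 3)} (hu : ‖u‖ = 1) (hu₀ : g₀.linearIsometryEquiv u = u)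

include hsm₀ hne₀ hu hu₀ in
/-- **A point of the axis line (T7).**  With `t = g₀ q - q` and `t^⊥ = t - ⟨t, u⟩ u`, T7 gives `c ⊥ u`
with `B₀ c - c = -t^⊥`; then `c₀ = c + q` has `g₀ c₀ - c₀ = ⟨t, u⟩ u`. -/
theorem fpg_axis_point
    (hT7 : ∀ A : EuclideanSpace ℝ (Fin 3) ≃ₗᵢ[ℝ] EuclideanSpace ℝ (Fin 3),
      (∀ x : EuclideanSpace ℝ (Fin 3), ‖A x - x‖ ≤ ‖x‖ / 2) → ∀ u : EuclideanSpace ℝ (Fin 3), ‖u‖ = 1 →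
        A u = u → (∃ x : EuclideanSpace ℝ (Fin 3), A x ≠ x) → ∀ w : EuclideanSpace ℝ (Fin 3),
          inner ℝ w u = 0 → ∃ c : EuclideanSpace ℝ (Fin 3), inner ℝ c u = 0 ∧ A c - c = w)
    (q : EuclideanSpace ℝ (Fin 3)) :
    ∃ c₀ : EuclideanSpace ℝ (Fin 3), ∃ a : ℝ, g₀ c₀ - c₀ = a • u := by
  have hBhalf := fpg_small_half (by norm_num) hsm₀
  have hperp : inner ℝ (-((g₀ q - q) - inner ℝ (g₀ q - q) u • u)) u = 0 := by
    rw [inner_neg_left, inner_sub_left, real_inner_smul_left, real_inner_self_eq_norm_sq, hu]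
    ring
  obtain ⟨c, -, hc⟩ := hT7 _ hBhalf u hu hu₀ hne₀ _ hperp
  refine ⟨c + q, inner ℝ (g₀ q - q) u, ?_⟩
  rw [fpg_map_add]
  have e : g₀.linearIsometryEquiv c + g₀ q - (c + q) = (g₀.linearIsometryEquiv c - c) + (g₀ q - q) := by
    abel
  rw [e, hc]
  abel

include hT2 hsm₀ hne₀ hu hu₀ in
/-- **Structure of the axis set (T2).**  If `g₀ c₀ - c₀ = a • u` and `g₀ x - x = c • u`, then
`x - c₀ ∈ ℝ u`: `B₀ (x - c₀) - (x - c₀) = (c - a) • u` is orthogonal to `u`, hence `0`, so `x - c₀` is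
`B₀`-fixed. -/
theorem fpg_axis_structure {c₀ : EuclideanSpace ℝ (Fin 3)} {a : ℝ} (hc₀ : g₀ c₀ - c₀ = a • u)
    {x : EuclideanSpace ℝ (Fin 3)} {c : ℝ} (hx : g₀ x - x = c • u) : ∃ t : ℝ, x - c₀ = t • u := by
  have hBhalf := fpg_small_half (by norm_num) hsm₀
  have h1 : g₀.linearIsometryEquiv (x - c₀) - (x - c₀) = (c - a) • u := by
    rw [← fpg_map_sub, sub_smul, ← hx, ← hc₀]
    abel
  have h2 : c - a = 0 :=
    fpg_smul_coeff_eq_zero hu (by rw [← h1]; exact fpg_inner_sub_fixed _ hu₀ _)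
  have h3 : g₀.linearIsometryEquiv (x - c₀) = x - c₀ := by
    rw [h2, zero_smul] at h1
    exact sub_eq_zero.mp h1
  exact hT2 _ hBhalf u hu hu₀ hne₀ _ h3

variable
  (hG1a : ∀ D : Delone.DeloneSet (EuclideanSpace ℝ (Fin 3)),
    ∀ g₁ g₂ : EuclideanSpace ℝ (Fin 3) ≃ᵃⁱ[ℝ] EuclideanSpace ℝ (Fin 3),
      g₁ '' (D : Set (EuclideanSpace ℝ (Fin 3))) = (D : Set (EuclideanSpace ℝ (Fin 3))) →
      g₂ '' (D : Set (EuclideanSpace ℝ (Fin 3))) = (D : Set (EuclideanSpace ℝ (Fin 3))) →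
      (∀ x : EuclideanSpace ℝ (Fin 3), ‖g₁.linear x - x‖ ≤ ‖x‖ / 10) →
      (∀ x : EuclideanSpace ℝ (Fin 3), ‖g₂.linear x - x‖ ≤ ‖x‖ / 10) →
        ∀ x : EuclideanSpace ℝ (Fin 3), g₁.linear (g₂.linear x) = g₂.linear (g₁.linear x))
  (hT0 : ∀ S : Set (EuclideanSpace ℝ (Fin 3) ≃ₗᵢ[ℝ] EuclideanSpace ℝ (Fin 3)), S.Infinite → ∀ ε : ℝ,
    0 < ε → ∃ A ∈ S, ∃ B ∈ S, A ≠ B ∧ ∀ x : EuclideanSpace ℝ (Fin 3), ‖A x - B x‖ ≤ ε * ‖x‖)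
  {D : Delone.DeloneSet (EuclideanSpace ℝ (Fin 3))}
  (hg₀ : g₀ '' (D : Set (EuclideanSpace ℝ (Fin 3))) = (D : Set (EuclideanSpace ℝ (Fin 3))))
  (hinf : {A : EuclideanSpace ℝ (Fin 3) ≃ₗᵢ[ℝ] EuclideanSpace ℝ (Fin 3) |
      ∃ g : EuclideanSpace ℝ (Fin 3) ≃ᵃⁱ[ℝ] EuclideanSpace ℝ (Fin 3),
        g '' (D : Set (EuclideanSpace ℝ (Fin 3))) = (D : Set (EuclideanSpace ℝ (Fin 3))) ∧
          g.linearIsometryEquiv = A}.Infinite)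

include hT2 hsm₀ hne₀ hu hu₀ hG1a hT0 hg₀ hinf in
/-- **Invariance of the axis line.**  If `g₀ c₀ - c₀ = a • u` then `g⁻¹ c₀ ∈ c₀ + ℝ u` for every symmetry
`g` of `D`: with `h = g g₀ g⁻¹` (commuting with `g₀`, linear part fixing `u`, part B) one has
`g₀ (h c₀) - h c₀ = Q (a • u) = a • u`, so `h c₀ = c₀ + c₁ u`; then
`g₀ (g⁻¹ c₀) = g⁻¹ (h c₀) = g⁻¹ c₀ ± c₁ u`, so `g⁻¹ c₀` lies on the axis set, i.e. on `c₀ + ℝ u`. -/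
theorem fpg_axis_invariant {c₀ : EuclideanSpace ℝ (Fin 3)} {a : ℝ} (hc₀ : g₀ c₀ - c₀ = a • u)
    {g : EuclideanSpace ℝ (Fin 3) ≃ᵃⁱ[ℝ] EuclideanSpace ℝ (Fin 3)}
    (hg : g '' (D : Set (EuclideanSpace ℝ (Fin 3))) = (D : Set (EuclideanSpace ℝ (Fin 3)))) :
    ∃ t : ℝ, g⁻¹ c₀ - c₀ = t • u := by
  have hcomm := fpg_comm_conj hT2 hG1a hg₀ hsm₀ hne₀ hu hu₀ hT0 hinf hg
  have hQu := fpg_conj_fix hT2 hG1a hg₀ hsm₀ hne₀ hu hu₀ hg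
  have h1 : g₀ ((g * g₀ * g⁻¹) c₀) - (g * g₀ * g⁻¹) c₀ = a • u := by
    have e : g₀ ((g * g₀ * g⁻¹) c₀) = (g * g₀ * g⁻¹) (g₀ c₀) := by
      change (g₀ * (g * g₀ * g⁻¹)) c₀ = ((g * g₀ * g⁻¹) * g₀) c₀
      rw [hcomm]
    rw [e, fpg_map_sub, hc₀, LinearIsometryEquiv.map_smul, hQu]
  obtain ⟨c₁, hc₁⟩ := fpg_axis_structure hT2 hsm₀ hne₀ hu hu₀ hc₀ h1
  have h2 : g₀ (g⁻¹ c₀) = g⁻¹ ((g * g₀ * g⁻¹) c₀) := by simp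
  have h3 : (g * g₀ * g⁻¹) c₀ = c₁ • u + c₀ := by
    rw [← hc₁]
    abel
  have h4 : ∃ σ : ℝ, g.linearIsometryEquiv.symm u = σ • u := by
    rcases fpg_axis_dichotomy hT2 hG1a hg₀ hsm₀ hne₀ hu hu₀ (fpg_sym_inv g hg) with h | h
    · exact ⟨1, by rw [one_smul]; exact h⟩
    · exact ⟨-1, by rw [neg_one_smul]; exact h⟩
  obtain ⟨σ, hσ⟩ := h4
  have h5 : g₀ (g⁻¹ c₀) - g⁻¹ c₀ = (c₁ * σ) • u := by
    rw [h2, h3, fpg_map_add, fpg_lin_inv, LinearIsometryEquiv.map_smul, hσ, smul_smul]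
    abel
  exact fpg_axis_structure hT2 hsm₀ hne₀ hu hu₀ hc₀ h5

end AxisLine

/-- **FPG — COAXIAL COLLAPSE: FINITELY MANY ORBITS ⇒ FINITE POINT GROUP** (Bieberbach I for the case at
hand).  For a Delone `D ⊆ ℝ³` with finitely many `Sym(D)`-orbits, the point group
`{g.linearIsometryEquiv | g '' D = D}` is finite, given the SO(3) facts T0, T1, T2, T7 and Bieberbach's
lemma G1a as hypotheses.  Proof: cocompactness of `Sym(D) · 0` (part A) against the `Sym(D)`-invariant
axis line `c₀ + ℝ u` of a small nontrivial linear part (parts A, B and `fpg_axis_invariant`): every orbit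
point `g 0` is at distance `dist 0 c₀` from the point `g c₀` of the line, while the point
`c₀ + (dist 0 c₀ + R₁ + 1) w` (`w ⊥ u` a unit vector) is farther than `dist 0 c₀ + R₁` from the line. -/
theorem stub_finitePointGroup :
    (∀ S : Set (EuclideanSpace ℝ (Fin 3) ≃ₗᵢ[ℝ] EuclideanSpace ℝ (Fin 3)), S.Infinite → ∀ ε : ℝ, 0 < ε → ∃ A ∈ S, ∃ B ∈ S, A ≠ B ∧ ∀ x : EuclideanSpace ℝ (Fin 3), ‖A x - B x‖ ≤ ε * ‖x‖) →
    (∀ A : EuclideanSpace ℝ (Fin 3) ≃ₗᵢ[ℝ] EuclideanSpace ℝ (Fin 3), (∀ x : EuclideanSpace ℝ (Fin 3), ‖A x - x‖ ≤ ‖x‖ / 2) → ∃ u : EuclideanSpace ℝ (Fin 3), ‖u‖ = 1 ∧ A u = u) →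
    (∀ A : EuclideanSpace ℝ (Fin 3) ≃ₗᵢ[ℝ] EuclideanSpace ℝ (Fin 3), (∀ x : EuclideanSpace ℝ (Fin 3), ‖A x - x‖ ≤ ‖x‖ / 2) → ∀ u : EuclideanSpace ℝ (Fin 3), ‖u‖ = 1 → A u = u → (∃ x : EuclideanSpace ℝ (Fin 3), A x ≠ x) → ∀ v : EuclideanSpace ℝ (Fin 3), A v = v → ∃ c : ℝ, v = c • u) →
    (∀ A : EuclideanSpace ℝ (Fin 3) ≃ₗᵢ[ℝ] EuclideanSpace ℝ (Fin 3), (∀ x : EuclideanSpace ℝ (Fin 3), ‖A x - x‖ ≤ ‖x‖ / 2) → ∀ u : EuclideanSpace ℝ (Fin 3), ‖u‖ = 1 → A u = u → (∃ x : EuclideanSpace ℝ (Fin 3), A x ≠ x) → ∀ w : EuclideanSpace ℝ (Fin 3), inner ℝ w u = 0 → ∃ c : EuclideanSpace ℝ (Fin 3), inner ℝ c u = 0 ∧ A c - c = w) →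
    (∀ D : Delone.DeloneSet (EuclideanSpace ℝ (Fin 3)), ∀ g₁ g₂ : EuclideanSpace ℝ (Fin 3) ≃ᵃⁱ[ℝ] EuclideanSpace ℝ (Fin 3), g₁ '' (D : Set (EuclideanSpace ℝ (Fin 3))) = (D : Set (EuclideanSpace ℝ (Fin 3))) → g₂ '' (D : Set (EuclideanSpace ℝ (Fin 3))) = (D : Set (EuclideanSpace ℝ (Fin 3))) → (∀ x : EuclideanSpace ℝ (Fin 3), ‖g₁.linear x - x‖ ≤ ‖x‖ / 10) → (∀ x : EuclideanSpace ℝ (Fin 3), ‖g₂.linear x - x‖ ≤ ‖x‖ / 10) → ∀ x : EuclideanSpace ℝ (Fin 3), g₁.linear (g₂.linear x) = g₂.linear (g₁.linear x)) →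
    ∀ D : Delone.DeloneSet (EuclideanSpace ℝ (Fin 3)), Literature.Geometry.DiscreteGeometry.HasFinitelyManySymmetryOrbits (D : Set (EuclideanSpace ℝ (Fin 3))) → {A : EuclideanSpace ℝ (Fin 3) ≃ₗᵢ[ℝ] EuclideanSpace ℝ (Fin 3) | ∃ g : EuclideanSpace ℝ (Fin 3) ≃ᵃⁱ[ℝ] EuclideanSpace ℝ (Fin 3), g '' (D : Set (EuclideanSpace ℝ (Fin 3))) = (D : Set (EuclideanSpace ℝ (Fin 3))) ∧ g.linearIsometryEquiv = A}.Finite := by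
  intro hT0 hT1 hT2 hT7 hG1a D hfin
  by_contra hinf
  -- (A) cocompactness of the orbit of the origin
  obtain ⟨R₁, hR₁, hcpt⟩ := fpg_cocompact D hfin 0
  -- (B1, B2) a small nontrivial linear part `B₀` and its axis `u`
  obtain ⟨g₀, hg₀, hne₀, hsm₀⟩ := fpg_exists_small hT0 hinf (by norm_num : (0 : ℝ) < 1 / 20)
  obtain ⟨u, hu, hu₀⟩ := hT1 _ (fpg_small_half (by norm_num) hsm₀)
  -- (B6) a point `c₀` of the axis line
  obtain ⟨c₀, a, hc₀⟩ := fpg_axis_point hsm₀ hne₀ hu hu₀ hT7 0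
  -- a unit vector `w ⊥ u`
  have ⟨x₁, hx₁⟩ := hne₀
  have hw'0 : g₀.linearIsometryEquiv x₁ - x₁ ≠ 0 := sub_ne_zero.mpr hx₁
  have hw'u : inner ℝ (g₀.linearIsometryEquiv x₁ - x₁) u = 0 := fpg_inner_sub_fixed _ hu₀ x₁
  obtain ⟨w, hw1, hwu⟩ : ∃ w : EuclideanSpace ℝ (Fin 3), ‖w‖ = 1 ∧ inner ℝ w u = 0 :=
    ⟨‖g₀.linearIsometryEquiv x₁ - x₁‖⁻¹ • (g₀.linearIsometryEquiv x₁ - x₁),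
      norm_smul_inv_norm (𝕜 := ℝ) hw'0, by rw [real_inner_smul_left, hw'u, mul_zero]⟩
  -- (B7) the far point `z = R • w + c₀`
  obtain ⟨R, hR⟩ : ∃ R : ℝ, R = dist (0 : EuclideanSpace ℝ (Fin 3)) c₀ + R₁ + 1 := ⟨_, rfl⟩
  have hR0 : 0 ≤ R := by rw [hR]; positivity
  obtain ⟨g, hg, hgz⟩ := hcpt (R • w + c₀)
  obtain ⟨t, ht⟩ := fpg_axis_invariant hT2 hsm₀ hne₀ hu hu₀ hG1a hT0 hg₀ hinf hc₀ (fpg_sym_inv g hg)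
  rw [inv_inv] at ht
  have h1 : dist (g 0) (g c₀) = dist (0 : EuclideanSpace ℝ (Fin 3)) c₀ := g.dist_map 0 c₀
  have h2 : R ≤ dist (R • w + c₀) (g c₀) := by
    have e : R • w + c₀ - g c₀ = R • w - t • u := by
      rw [← ht]
      abel
    have hsq : ‖R • w - t • u‖ ^ 2 = R ^ 2 + t ^ 2 := by
      rw [norm_sub_sq_real, norm_smul, norm_smul, hw1, hu, real_inner_smul_left, real_inner_smul_right,
        hwu, Real.norm_eq_abs, Real.norm_eq_abs, mul_one, mul_one, sq_abs, sq_abs]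
      ring
    rw [dist_eq_norm, e]
    nlinarith [norm_nonneg (R • w - t • u), sq_nonneg t, hsq]
  have h3 := dist_triangle (R • w + c₀) (g 0) (g c₀)
  rw [h1, dist_comm (R • w + c₀) (g 0)] at h3
  linarith

end Summit.AtomisticToContinuum.Crystallization.Theorems.IsometryAtomsAtomicLawChargesCrystal
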